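import Mathlib
import Summits.MatrixMultiplication.MatrixMultiplication.Theses.HiddenToeplitzCorners
import Summits.MatrixMultiplication.MatrixMultiplication.Theorems.HiddenToeplitzCornersHiddenCornersStubInstance
import Summits.MatrixMultiplication.MatrixMultiplication.Theorems.HiddenToeplitzCornersHiddenCornersStubTransfer

/-!
# Crux `HiddenCorners` (stmt-MatrixMultiplication-7492) — line `ApolarSketch`, lead a1's skeleton (shape A), v3

The honest (δ = 2, split d = 1) face of the crux, read through the flip `J` as a HANKEL pencil
`H_W(X) i j = tr (X * W (i + j))` (symbol `k ↦ tr (X * W k)`, `k < 2N - 1`).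

* `stub_instance` — LANDED (p113538, `Theorems/HiddenToeplitzCornersHiddenCornersStubInstance.lean`): per-instance
  packaging `T a b i j := W (i + (N - 1 - j)) b a`, split Stein identity with `d = 1`, sparsity `Σ_k nnz (W k)`,
  `det T(X) = 0 ↔ det H_W(X) = 0`.
* `stub_transfer` — LANDED (p112572, `Theorems/HiddenToeplitzCornersHiddenCornersStubTransfer.lean`): the ε / `∃ᶠ`
  bookkeeping from the instance statement and C⁺(δ = 2) to the body of `HiddenCorners`.
* `stub_honest` — C⁺(δ = 2) = `HonestHankelCorners`, inlined: the load-bearing existence statement, OPEN and believed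
  FALSE for `r ≥ 3`: see Cruxes/HiddenCorners/HonestHankelNoGo.md (Theorems A, B, E, F, G, H: ruling, bi-ruling and
  low-rank mechanisms are impossible for every `r ≥ 3` and every `N`; any honest `r = 3` witness needs `N ≥ 9`; any
  honest witness needs `N ≥ r²`) and the landed negative-side helpers `honest_sq_le` (p115023) and
  `hankel_coprime_kernel`.

`HiddenCorners_of` composes the three stubs into the crux BY NAME and is sorry-free modulo `stub_honest`.
-/

set_option linter.dupNamespace false

namespace Summit.MatrixMultiplication.MatrixMultiplication.Cruxes.HiddenCorners.ApolarSketch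

open Summit.MatrixMultiplication.MatrixMultiplication.Theses.HiddenToeplitzCorners
open scoped BigOperators Matrix

/-- STUB 3 — C⁺(δ = 2), `HonestHankelCorners` inlined (the lead's stub): for every `ε > 0` and infinitely many `r`
there is an honest Hankel placement `W` of size `N ≤ r^(2+ε)`, vanishing beyond `2N - 2`, of total sparsity
`Σ_k nnz (W k) ≤ r^(2+ε)`, generically nonsingular and singular on every singular `X`. -/
theorem stub_honest :
    ∀ ε : ℝ, 0 < ε → ∃ᶠ r : ℕ in Filter.atTop, ∃ N : ℕ, (N : ℝ) ≤ (r : ℝ) ^ (2 + ε) ∧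
      ∃ W : ℕ → Matrix (Fin r) (Fin r) ℂ, (∀ k, 2 * N - 1 ≤ k → W k = 0) ∧
        (((∑ k ∈ Finset.range (2 * N - 1),
            (Finset.univ.filter fun p : Fin r × Fin r => W k p.1 p.2 ≠ 0).card : ℕ) : ℝ)
              ≤ (r : ℝ) ^ (2 + ε)) ∧
        (∃ X₀ : Matrix (Fin r) (Fin r) ℂ,
          (Matrix.of fun i j : Fin N => (X₀ * W ((i : ℕ) + (j : ℕ))).trace).det ≠ 0) ∧
        ∀ X : Matrix (Fin r) (Fin r) ℂ, X.det = 0 →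
          (Matrix.of fun i j : Fin N => (X * W ((i : ℕ) + (j : ℕ))).trace).det = 0 := by
  sorry

/-- ASSEMBLY — the crux by name, sorry-free modulo `stub_honest`. -/
theorem HiddenCorners_of : HiddenCorners :=
  stub_transfer stub_instance stub_honest

end Summit.MatrixMultiplication.MatrixMultiplication.Cruxes.HiddenCorners.ApolarSketch
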